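import Summits.SmoothPoincare4.SmoothPoincare4.Theorems.InformationMetricHadamardAhHadamardFillingUcstReduction

/-!
# Stub `stub_collarEndHadamard` (T) of line `fisher-sphere-gauss`
(crux `InformationMetricHadamard.AhHadamardFilling`, item stmt-SmoothPoincare4-6014)

The topology component of the line: a CONNECTED Riemannian 5-manifold `(W, G)` with `sec ≤ 0`
carrying the crux's collar `Φ : Σ × (0,1) → W` over a homotopy 4-sphere `Σ` (smooth, injective,
co-compact far parts, closure clause, `C⁰` cone asymptotics `G ∼ c (dλ² + g)/λ²`, `c > 0`) is
complete — every closed distance ball `{y | d(x,y) ≤ r}` is compact — and simply connected.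

Both conjuncts are landed theorems of line `universal-cover-strips-topology`
(`Theorems/InformationMetricHadamardAhHadamardFillingUcstReduction.lean`, p124840):
`UniversalCoverStripsTopology.isCompact_setOf_edist_le_of_collar` (far points are far, so a closed
ball is a closed subset of a compact far complement) and
`UniversalCoverStripsTopology.simplyConnected_of_connectedCollarFilling` (Cartan–Hadamard covering
`exp_p : ℝ⁵ → W` + one end of `ℝ⁵`).  The closure clause `hcl` is part of the registered signature
but is not needed (it is itself automatic, `closure_image_far_subset_of_collar`).
Everything is proved (kind = proof); no definitions.
-/

noncomputable section

-- the prescribed namespace `Summit.<P>.<Sub>.…` duplicates `SmoothPoincare4` (P = Sub)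
set_option linter.dupNamespace false

open scoped Manifold ContDiff Topology ENNReal NNReal
open Set Function MeasureTheory Topology

namespace Summit.SmoothPoincare4.SmoothPoincare4.Cruxes.AhHadamardFilling.FisherSphereGauss

open Literature.Topology.FourManifolds (HomotopySphere)
open Literature.Geometry.Lorentzian (PseudoRiemannianMetric)

/-- **T (`collarEndHadamard`).** Let `(W, G)` be a CONNECTED Riemannian 5-manifold with `sec ≤ 0`
(for every Levi-Civita connection) carrying the crux's collar data over a homotopy 4-sphere `Σ`
verbatim: `Φ : Σ × ℝ → W` smooth and injective on `Σ × (0,1)`, far parts `Φ(Σ × (0,t))` co-compact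
with the closure clause, and `G` `C⁰`-asymptotic to `c (dλ² + g)/λ²` with `c > 0`. Then
(i) `(W, G)` is complete — closed distance balls are compact: far points are metrically far, so a
closed ball is a closed subset of some compact far complement `(Φ(Σ × (0,t)))ᶜ`
(`UniversalCoverStripsTopology.isCompact_setOf_edist_le_of_collar`); and (ii) `W` is simply
connected: `exp_p : ℝ⁵ → W` is a covering map (Cartan–Hadamard), the collar's far part lifts to
`|π₁ W|` disjoint open sheets with compact frontier and non-compact closure, and the one-ended `ℝ⁵`
holds at most one (`UniversalCoverStripsTopology.simplyConnected_of_connectedCollarFilling`).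
The closure clause `hcl` is not used (it is automatic). [cite: LeeRiemannianManifolds2018, Thm 12.8] -/
theorem stub_collarEndHadamard (S : HomotopySphere 4)
    (g : PseudoRiemannianMetric (𝓡 4) ∞ (EuclideanSpace ℝ (Fin 4)) (TangentSpace (𝓡 4) : S.carrier → Type _))
    (hg : g.IsRiemannian)
    (W : Type) [TopologicalSpace W] [T2Space W] [SecondCountableTopology W]
    [ChartedSpace (EuclideanSpace ℝ (Fin 5)) W] [IsManifold (𝓡 5) ∞ W] [ConnectedSpace W]
    (G : PseudoRiemannianMetric (𝓡 5) ∞ (EuclideanSpace ℝ (Fin 5)) (TangentSpace (𝓡 5) : W → Type _))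
    (hG : G.IsRiemannian) (c : ℝ) (Φ : S.carrier × ℝ → W) (hc : 0 < c)
    (hsec : ∀ cov, G.IsLeviCivita cov →
      ∀ (x : W) (X Y : TangentSpace (𝓡 5) x), G.sectionalCurvature cov x X Y ≤ 0)
    (hsm : ContMDiffOn ((𝓡 4).prod 𝓘(ℝ, ℝ)) (𝓡 5) ∞ Φ (univ ×ˢ Ioo (0 : ℝ) 1))
    (hinj : InjOn Φ (univ ×ˢ Ioo (0 : ℝ) 1))
    (hco : ∀ t ∈ Ioo (0 : ℝ) 1, IsCompact (Φ '' (univ ×ˢ Ioo (0 : ℝ) t))ᶜ)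
    (hcl : ∀ t ∈ Ioo (0 : ℝ) 1, closure (Φ '' (univ ×ˢ Ioo (0 : ℝ) t)) ⊆ Φ '' (univ ×ˢ Ioo (0 : ℝ) 1))
    (hasym : ∀ ε : ℝ, 0 < ε → ∃ t ∈ Ioo (0 : ℝ) 1, ∀ (x : S.carrier) (l : ℝ), l ∈ Ioo (0 : ℝ) t →
      ∀ (v : TangentSpace (𝓡 4) x) (s : ℝ),
        |G.val (Φ (x, l)) (mfderiv ((𝓡 4).prod 𝓘(ℝ, ℝ)) (𝓡 5) Φ (x, l) (v, s))
            (mfderiv ((𝓡 4).prod 𝓘(ℝ, ℝ)) (𝓡 5) Φ (x, l) (v, s)) -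
          c * (s ^ 2 + g.val x v v) / l ^ 2| ≤ ε * (c * (s ^ 2 + g.val x v v) / l ^ 2)) :
    (∀ (x : W) (r : NNReal), IsCompact {y : W | G.edist hG x y ≤ r}) ∧ SimplyConnectedSpace W := by
  -- the closure clause is part of the registered signature but is not needed below (it is
  -- automatic, `UniversalCoverStripsTopology.closure_image_far_subset_of_collar`)
  have _ := hcl
  exact ⟨UniversalCoverStripsTopology.isCompact_setOf_edist_le_of_collar g hg G hG Φ hc hsm hinj
      hasym hco,
    UniversalCoverStripsTopology.simplyConnected_of_connectedCollarFilling S g hg W G hG c Φ hc hsec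
      hsm hinj hco hasym⟩

end Summit.SmoothPoincare4.SmoothPoincare4.Cruxes.AhHadamardFilling.FisherSphereGauss

end
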